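import Summits.QuantumFields.YangMills.Theorems.UnitScaleTiltProp7FlatJRowConst
import Summits.QuantumFields.YangMills.Theorems.UnitScaleTiltProp7FlatInterpolantOrth
import HarnessLib

/-!
# Route `UnitScaleTilt`, crux K1 «MinimiserStabilityRegPr» (stmt-QuantumFields-19200), route-R E′ S3 ∕ line «HKGK-ANALYTIC», row J-ROW★ — v1.1 OF ✓p683429 `Prop7FlatJRowConst.flatJRow_const(_T3)`
# WITHOUT THE PER-DIRECTION MEAN-ZERO HYPOTHESIS `hν`: it follows from the pairing `hf` and `hLap` alone (★ym-ust-19936-w8 g5 ✓p683722 `Prop7FlatInterpolantOrth.sum_dir_weight_eq_zero`,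
# the (C1) LOCATE item (2); ★ym-ust-19200-w4 g7 00:48:33Z (c) «dischargeable by a 3-line v1.1»)

Cell `ym3-torus`, width seat `ym3-torus-px6` (gen 4).  THEOREMS ONLY (0 `def`, 0 `sorry`); `--supports stmt-QuantumFields-19200 --as helper`, count-neutral.  YM₃ on T³ is a ladder rung
(R3), not the Clay problem; nothing here claims S3, hKg-K, E′, the stub, the crux, d = 4 or the mass gap.

WHAT IS PROVED (ns `…Theorems.Prop7FlatJRowConst`): ★★★ `flatJRow_const_of_pairing` — ✓p683429's `flatJRow_const` with `hν` discharged (`Σ_y ν⟨y,κ⟩ = Σ_x f⟨x,κ⟩ = Σ_x (ΔA_κ)(x) = 0`);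
★ `flatJRow_const_of_pairing_T3` — the T³ instance (`k = K − n`).  Twin of w8's ✓`flatRRow_const_of_pairing(_T3)` one Bernstein order up; same hypothesis list.
HONEST SCOPE.  Bookkeeping; no new estimate.

References: T. Bałaban, CMP 95 (1984) 17–40 [Balaban1984PropagatorsI] ((1.18) p.20, (1.21) p.21, Sect. C p.22); CMP 102 (1985) 277–309 [Balaban1985Variational] (Prop. 7 p.299).
-/

set_option autoImplicit false

noncomputable section

open scoped BigOperators

namespace Summit.QuantumFields.YangMills.Theorems.Prop7FlatJRowConst

open Literature.MathematicalPhysics.QuantumFieldTheory.Balaban1983to89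
open LatticeFieldCalculus
open Summit.QuantumFields.YangMills.Theorems.Prop7FlatInterpolantOrth (sum_dir_weight_eq_zero)

variable {P : Params} {k : ℕ}

/-- ★★★ **J-ROW★'s FLAT CORE IN `Site P 0` LETTERS, NO `hν`**: for a real level-`k` weight `ν`, its `Q_k`-transpose `f` and a fine real bond field `A` with `Δ A_κ = f_κ` and `Σ_x A⟨x,κ⟩ = 0`,
`(L^k)²·Σ_b ((ΔA)(b))² ≤ dπ²(1 + (π²∕4)^{d+1})·Σ_b Σ_ν (A(b + e_ν) − A(b))²` — ✓`flatJRow_const` with the per-direction mean-zero of `ν` supplied by ✓`sum_dir_weight_eq_zero`.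
[cite: Balaban1984PropagatorsI, (1.18) p.20, (1.21) p.21, Sect. C p.22; Balaban1985Variational, Prop. 7 p.299] -/
theorem flatJRow_const_of_pairing (hk : k ≤ P.m + P.K) (ν : PBond P k → ℝ) (A f : PBond P 0 → ℝ)
    (hf : ∀ Y : PBond P 0 → ℝ, ∑ c : PBond P k, ν c * bondAvgIter k Y c = ∑ b : PBond P 0, f b * Y b)
    (hLap : ∀ b : PBond P 0, laplace 1 (fun z => A ⟨z, b.dir⟩) b.src = f b)
    (hA0 : ∀ κ : Fin P.d, ∑ x : Site P 0, A ⟨x, κ⟩ = 0) :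
    ((P.L : ℝ) ^ k) ^ 2 * ∑ b : PBond P 0, (laplace 1 (fun z => A ⟨z, b.dir⟩) b.src) ^ 2
      ≤ (P.d * Real.pi ^ 2 * (1 + (Real.pi ^ 2 / 4) ^ (P.d + 1)))
          * ∑ b : PBond P 0, ∑ ν' : Fin P.d, (A ⟨b.src.shift ν', b.dir⟩ - A b) ^ 2 :=
  flatJRow_const hk ν (fun κ => sum_dir_weight_eq_zero ν A f hf hLap κ) A f hf hLap hA0

/-- ★ **THE T³ INSTANCE, NO `hν`** (`k = K − n`, run `K` of a T³ family): `ℓ²·Σ_b((ΔA)(b))² ≤ C_B↑·Σ_bΣ_ν(A(b+e_ν) − A(b))²` for the flat curl-minimal interpolant of ANY level-`(K−n)`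
weight. [cite: Balaban1984PropagatorsI, (1.18) p.20, (1.21) p.21; Balaban1985Variational, Prop. 7 p.299] -/
theorem flatJRow_const_of_pairing_T3 (F : T3ContinuumYM3Torus.T3Family) (K n : ℕ) (ν : PBond (F.P K) (K - n) → ℝ)
    (A f : PBond (F.P K) 0 → ℝ)
    (hf : ∀ Y : PBond (F.P K) 0 → ℝ, ∑ c : PBond (F.P K) (K - n), ν c * bondAvgIter (K - n) Y c = ∑ b : PBond (F.P K) 0, f b * Y b)
    (hLap : ∀ b : PBond (F.P K) 0, laplace 1 (fun z => A ⟨z, b.dir⟩) b.src = f b)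
    (hA0 : ∀ κ : Fin (F.P K).d, ∑ x : Site (F.P K) 0, A ⟨x, κ⟩ = 0) :
    ((F.L : ℝ) ^ (K - n)) ^ 2 * ∑ b : PBond (F.P K) 0, (laplace 1 (fun z => A ⟨z, b.dir⟩) b.src) ^ 2
      ≤ ((F.P K).d * Real.pi ^ 2 * (1 + (Real.pi ^ 2 / 4) ^ ((F.P K).d + 1)))
          * ∑ b : PBond (F.P K) 0, ∑ ν' : Fin (F.P K).d, (A ⟨b.src.shift ν', b.dir⟩ - A b) ^ 2 := by
  have hk : K - n ≤ (F.P K).m + (F.P K).K := by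
    have := F.hm
    show K - n ≤ F.m + K
    omega
  exact flatJRow_const_of_pairing (P := F.P K) hk ν A f hf hLap hA0

end Summit.QuantumFields.YangMills.Theorems.Prop7FlatJRowConst

end
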